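import Summits.QuantumFields.BalabanUV.Beta.GAN24.WilsonPairFormCharge
import Summits.QuantumFields.BalabanUV.Beta.GAN24.SrecExitChargeLevelZero
import Summits.QuantumFields.BalabanUV.Beta.GAN24.SpureSlotChargeLevelZero

/-!
# `BalabanUV.Beta.GAN24.SrecChargeBlockPotentials` — binder row G-an2-4 ∕ (CONV-C), the (S) row of RULING R-gan24p1-g27-1 B (viii), road-P2's (W-γ) CHARGE TOWER
# (`W-GAMMA-TOWER-v0.md`, p2 g41) item §5 (b) «(I3)_0 for general block-constant potentials … + the Λ-piece for F∘blk», PART B: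
# **(I3)_0 — THE LEVEL-0 STEP TABLE's TWO-LEG ff CHARGE AGAINST `dψa ⊗ dψb` FOR ANY TWO BLOCK-CONSTANT POTENTIALS `ψ = h ∘ blk` IS `cE·(−¼)·d*d m[ψa,ψb]`: the rooted
# constraint Hessians and the whole Λ-letter (ANY placement, ANY coefficient family) contribute NOTHING (leaf-01's «the two coarse jumps never multiply» on the two-block
# support), the border table is off the ff block, the Wilson letter is PART A; the pure-S twin holds for EVERY pair of potentials; the class-𝒟 single-channel form
# (`G_i = F_i∘⌊·∕Lc⌋`, weights `𝟙^{exit}·ΔF_i(blk)`) and its same-direction vanishing**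
# (G-an2-4 formalisation swarm → CRUX TEAM (2), seat `b2b-balaban-gan24-formalise-leaf-02`, gen 57; INTENT [LEAF02-G57-INTENT1], PART B of two)

NOT IN PRINT; OUR BOOKKEEPING ([folklore] packaging BY NAME: PART A `WilsonPairFormCharge`, this seat's g47 `HessianGaugeLegContact.tsum_dz_mul_hessFFAt ∕ tsum_dz_mul_SLam_hessFFAt ∕
summable_mul_SLam_hessFFAt`, g56 `SrecExitChargeLevelZero.srecAt_zero_inl_inl`, g55 `WilsonLetterFlatCharges.spureRecAt_zero_inl_inl`, an3's `ContactOneGaugeCellAlgebra.summable_mul_wilsonA`,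
leaf-01's `ContactFaceJump.linKerAt_eq_zero_of_not_twoBlock ∕ blk_root ∕ blk_farRoot ∕ fourSite_mul_twoSite_eq_zero`; 0 `def`, 0 cited fact, 0 `def … : Prop`, 0 sorry).
HONEST FRAMING (cell contract, verbatim): «discharging `BetaPertH` makes Bałaban's UV stability UNCONDITIONAL — a real constructive-QFT result; it is NOT the continuum limit and
NOT the Clay problem.»  HONEST DEPENDENCY (verbatim): «continuum YM on T⁴ ⇐ BetaPertH ∧ nine spine estimates (0/9 proved); BetaPertH ⇐ (D1) ∧ (D4) ∧ CAP+tail; G-an2-4 gates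
asym, D1 and NE2/3/4.»

WHY.  p2 g41's INDUCTION (memo §2): «(I3)_0 [leaf-02 PART 6∕7 for general single-coordinate ψ + Λ exit-free + VH ff = 0] and (I3)_j ⇒ (I3)_{j+1} by (I1)+(I2)+(I4)+(I5) [+ … Λ
exit⊗exit-free needs leaf-02's `fourSiteBlk_mul_exitFace_mul_linKerAt_eq_zero` for block-constant potentials F∘blk]».  g56 PART 2 proved the Λ-vanishing for the pure exit
indicators (`F = id`) by the pointwise four-site lemma; leaf-01 (`ContactFaceJump` §BlockConstant) has the same mechanism for ARBITRARY block-constant gauge functions in the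
`linCountAt` currency.  This file puts the two together: for `ψa = ha ∘ blk L`, `ψb = hb ∘ blk L` (ANY `ha hb` — all coordinates, not only one) the `dψa`-leg of every rooted
constraint Hessian `h^ρ_{(μ,y)}` is the four-site weight of `ψa` against `q¹,ρ∕2` (g47's `dψ`-law), and on the two-block support of `q¹,ρ` that weight times the one-bond jump
`dψb` VANISHES (interior bond: jump `0`; crossing bond: weight `0`); so (I3)_0 holds for the FULL step table `SrecAt … 0` with the Wilson value of PART A — for the whole block
class of the tower, in particular p2's pulled-back weights (E28 (B): the Λ-letter is charge-free in every block class, charged only against ENTRY faces — consistent: entry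
potentials are not block-constant).

WHAT (generic `d`; box root `ρ = toSite r`, `r ∈ box (d+1) L`, `1 ≤ L`; `m[φ₁,φ₂] β z := dzφ₂ β z·(φ₁ z + φ₁(z + e_β))`).
* §3 BLOCK-CONSTANT POTENTIALS: `fourSite_mul_dz_mul_linKerAt_eq_zero` (leaf-01's `fourSite_mul_twoSite_eq_zero` + two-block support, `linKerAt` currency);
  `sum_dz_mul_tsum_sum_dz_mul_hessFFAt_eq_zero` (pointwise in the outer leg) and **`tsum_sum_dz_mul_tsum_sum_dz_mul_hessFFAt_eq_zero`** (every `h^ρ_{(μ,y)}` is charge-free against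
  `dψa ⊗ dψb`); `sum_dz_mul_tsum_sum_dz_mul_SLam_hessFFAt_eq_zero` and **`tsum_sum_dz_mul_tsum_sum_dz_mul_SLam_hessFFAt_eq_zero`** (the whole Λ-letter, ANY `N`, ANY `c` — in
  particular Bałaban's `lamCoeffOf KInv Lc` and the higher-level `lamCoeffK …`).
* §4 THE END: **`tsum_sum_dz_mul_tsum_sum_dz_mul_srecAt_zero`** — `Σ'_z Σ_β dzψb β z·(Σ'_x Σ_α dzψa α x·SrecAt d Lc ρ cE cVH cΛ 0 κ u x z (inl α)(inl β))
  = cE·(−¼·(d*d m[ψa,ψb])_κ(u))`; the pure-S twin **`…_spureRecAt_zero`** for EVERY pair of potentials and any root offset; the class-𝒟 single-channel form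
  **`tsum_blockWt_tsum_blockWt_srecAt_zero`** (`Σ'_z ΔG₂(z_b)·Σ'_x ΔG₁(x_a)·S₀ κ u x z (inl a)(inl b) = cE·(−¼·(d*d m)_κ(u))`, `G_i = F_i∘(⌊·∕Lc⌋)`, ANY `F₁ F₂`; by PART A's
  `blockPot_forwardDiff` the weights are `𝟙^{exit}_{a_i}·ΔF_i(blk)`, p2's `f_i = ΔF_i`) and **`…_same`** (`a = b` ⇒ `0`).  g56 PART 2's END is the instance `F₁ = F₂ = id`.
* §5 ROAD-P2's PAIR CURRENCY (`ChargeTowerStep` ∕ `ChargeTowerClimb` read `Σ'_{(x,z)} g₁(x)·g₂(z)·S κ u x z a b` on `Site × Site`): `summable_prod_wt_mul_of_biLoc`,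
  **`hasSum_prod_blockWt_srecAt_zero`** (bounded coarse differences; summability from `locStencil_SrecAt`, Fubini to §4), **`hasSum_prod_coordWt_spureRecAt_zero`** (pure S, every
  single-coordinate pair with bounded differences), `blockPot_forwardDiff_eq_exitWt` and **`hasSum_prod_exitWt_srecAt_zero`** (p2's literal weights
  `if x_a % Lc = Lc−1 then f (blk Lc x a) else 0`, bounded `f_i`, ANY primitives `F_i`: the hypothesis `hC` of `ChargeTowerClimb` §7 one level down, with `d*d` and `c = 0`),
  `curvAdj_curv_const_mul` and **`tsum_prod_exitWt_srecAt_zero`** (the same as a `tsum` with the constant FOLDED into the potential, `m := (−cE∕4)•m[…]` — p2 INTENT 5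
  `ChargeTowerClimbZero` §4's `hC` literally, `c = 0`).
Asserts NO value of any resolvent column or read vector; NOTHING of (W-γ)'s exit sub-row at `j ≥ 1` ∕ (INV) ∕ (S) ∕ (Q-R) ∕ (DL) ∕ (LT) ∕ (Q-L) ∕ (C) ∕ «T2Shape» ∕ (hW, hWall)
discharged; NEVER «G-an2-4 closed» as (CONV-C); NOT D1, NOT `BetaPertH`, NOT continuum, NOT Clay.  2026-08-22; no existing file touched.
-/

noncomputable section

open Finset
open scoped BigOperators
open Literature.MathematicalPhysics.QuantumFieldTheory
open Literature.MathematicalPhysics.QuantumFieldTheory.Balaban1983to89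
open Literature.MathematicalPhysics.QuantumFieldTheory.Balaban1983to89.Beta
open ExpKernelCalculus (Site MKer BiLoc summable_exp_shift')
open OneStepResolventKernel (Fib KInv LocStencil)
open AffineAveraging (Form1 Form2 box toSite unitVec unitVec_apply dz curv curvAdj curv_dz)
open AveragingContours (blk)
open AveragingHessianKernelsRooted (hessFFAt linKerAt)
open StepJetData (wilsonA)
open InterLevelTransport (SLam)
open BalabanStepJets (lamCoeffOf)
open B12Sec2to5 (l1)
open Summit.QuantumFields.BalabanUV.Beta.SpineRooted (SpureRecAt locStencil_SpureRecAt)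
open Summit.QuantumFields.BalabanUV.Beta.WardLocusRecursive (SrecAt locStencil_SrecAt)
open Summit.QuantumFields.BalabanUV.Beta.GAN24.ContactOneGaugeCellAlgebra (summable_mul_wilsonA)
open Summit.QuantumFields.BalabanUV.Beta.GAN24.SymLinKernelFaceSupport (int_ediv_add_one)
open Summit.QuantumFields.BalabanUV.Beta.GAN24.WilsonLetterFlatCharges (spureRecAt_zero_inl_inl)
open Summit.QuantumFields.BalabanUV.Beta.GAN24.HessianGaugeLegContact (tsum_dz_mul_hessFFAt tsum_dz_mul_SLam_hessFFAt summable_mul_SLam_hessFFAt)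
open Summit.QuantumFields.BalabanUV.Beta.GAN24.ContactFaceJump (linKerAt_eq_zero_of_not_twoBlock blk_root blk_farRoot fourSite_mul_twoSite_eq_zero)
open Summit.QuantumFields.BalabanUV.Beta.GAN24.SrecExitChargeLevelZero (srecAt_zero_inl_inl)
open Summit.QuantumFields.BalabanUV.Beta.GAN24.SpureSlotChargeLevelZero (tsum_prod_eq_tsum_tsum_swap)
open Summit.QuantumFields.BalabanUV.Beta.GAN24.WilsonPairFormCharge (tsum_sum_dz_mul_tsum_sum_dz_mul_wilsonA sum_dz_coordPot_mul curvAdj_curv_pairForm_coord_same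
  tsum_coordWt_tsum_coordWt_wilsonA blockPot_forwardDiff)

namespace Summit.QuantumFields.BalabanUV.Beta.GAN24.SrecChargeBlockPotentials

variable {d : ℕ}

/-! ## §3 Block-constant potentials: the rooted constraint Hessians and the Λ-letter carry no charge -/

section BlockConstant

variable {L : ℕ} {r : Fin (d + 1) → ℕ}

/-- [folklore] **THE TWO COARSE JUMPS NEVER MULTIPLY, `linKerAt` currency** (leaf-01's `ContactFaceJump.fourSite_mul_twoSite_eq_zero` + two-block support; box root, `1 ≤ L`;
`ψa = ha ∘ blk L`, `ψb = hb ∘ blk L` ANY block-constant functions): `(ψa z + ψa(z+e_b) − ψa(L·y+ρ) − ψa(L·y+ρ+L·e_μ))·(ψb(z+e_b) − ψb z)·q¹,ρ_{(μ,y)}(b,z) = 0`. -/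
theorem fourSite_mul_dz_mul_linKerAt_eq_zero (hL : 1 ≤ L) (hr : r ∈ box (d + 1) L) {ψa ψb : Site (d + 1) → ℝ} (ha hb : Site (d + 1) → ℝ)
    (hψa : ∀ w, ψa w = ha (blk L w)) (hψb : ∀ w, ψb w = hb (blk L w)) (μ : Fin (d + 1)) (y : Site (d + 1)) (b : Fin (d + 1)) (z : Site (d + 1)) :
    (ψa z + ψa (z + unitVec b) - ψa ((L : ℤ) • y + toSite r) - ψa ((L : ℤ) • y + toSite r + (L : ℤ) • unitVec μ))
        * (ψb (z + unitVec b) - ψb z) * linKerAt (toSite r) L μ y (b, z) = 0 := by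
  simp only [hψa, hψb, blk_root y hr, blk_farRoot y μ hr]
  by_cases hq : (blk L z = y ∨ blk L z = y + unitVec μ) ∧ (blk L (z + unitVec b) = y ∨ blk L (z + unitVec b) = y + unitVec μ)
  · rw [fourSite_mul_twoSite_eq_zero ha hb hq.1 hq.2, zero_mul]
  · rw [linKerAt_eq_zero_of_not_twoBlock (f := (b, z)) hL hr hq, mul_zero]

/-- NOT IN PRINT; OUR BOOKKEEPING.  **POINTWISE IN THE OUTER LEG, ONE ROOTED CONSTRAINT HESSIAN**: for block-constant `ψa ψb` and every outer bond `(α′,x′)`,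
`Σ_{α′} dzψb α′ x′·(Σ'_x Σ_α dzψa α x·h^ρ_{(μ,y)} x x′ (inl α)(inl α′)) = 0` (the first-leg `dψ`-law gives the four-site weight of `ψa` on the bond `(α′,x′)` against `q¹,ρ∕2`). -/
theorem sum_dz_mul_tsum_sum_dz_mul_hessFFAt_eq_zero (hL : 1 ≤ L) (hr : r ∈ box (d + 1) L) {ψa ψb : Site (d + 1) → ℝ} (ha hb : Site (d + 1) → ℝ)
    (hψa : ∀ w, ψa w = ha (blk L w)) (hψb : ∀ w, ψb w = hb (blk L w)) (μ : Fin (d + 1)) (y x' : Site (d + 1)) :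
    ∑ α', dz ψb α' x' * ∑' x, ∑ α, dz ψa α x * hessFFAt (toSite r) L μ y x x' (Sum.inl α) (Sum.inl α') = 0 := by
  refine Finset.sum_eq_zero fun α' _ => ?_
  rw [tsum_dz_mul_hessFFAt hL hr μ y x' α' ψa]
  have h := fourSite_mul_dz_mul_linKerAt_eq_zero hL hr ha hb hψa hψb μ y α' x'
  have e : dz ψb α' x' * ((ψa x' + ψa (x' + unitVec α') - ψa ((L : ℤ) • y + toSite r) - ψa ((L : ℤ) • y + toSite r + (L : ℤ) • unitVec μ))
        * linKerAt (toSite r) L μ y (α', x') / 2)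
      = ((ψa x' + ψa (x' + unitVec α') - ψa ((L : ℤ) • y + toSite r) - ψa ((L : ℤ) • y + toSite r + (L : ℤ) • unitVec μ))
        * (ψb (x' + unitVec α') - ψb x') * linKerAt (toSite r) L μ y (α', x')) / 2 := by
    simp only [AffineAveraging.dz]
    ring
  rw [e, h, zero_div]

/-- NOT IN PRINT; OUR BOOKKEEPING.  **EVERY ROOTED CONSTRAINT HESSIAN IS CHARGE-FREE AGAINST `dψa ⊗ dψb` FOR BLOCK-CONSTANT POTENTIALS** (box root, every coarse bond `(μ,y)`):
`Σ'_{x′} Σ_{α′} dzψb α′ x′·(Σ'_x Σ_α dzψa α x·h^ρ_{(μ,y)} x x′ (inl α)(inl α′)) = 0`. -/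
theorem tsum_sum_dz_mul_tsum_sum_dz_mul_hessFFAt_eq_zero (hL : 1 ≤ L) (hr : r ∈ box (d + 1) L) {ψa ψb : Site (d + 1) → ℝ} (ha hb : Site (d + 1) → ℝ)
    (hψa : ∀ w, ψa w = ha (blk L w)) (hψb : ∀ w, ψb w = hb (blk L w)) (μ : Fin (d + 1)) (y : Site (d + 1)) :
    ∑' x', ∑ α', dz ψb α' x' * ∑' x, ∑ α, dz ψa α x * hessFFAt (toSite r) L μ y x x' (Sum.inl α) (Sum.inl α') = 0 := by
  simp only [sum_dz_mul_tsum_sum_dz_mul_hessFFAt_eq_zero hL hr ha hb hψa hψb, tsum_zero]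

variable {N : ℕ} [NeZero N]

/-- NOT IN PRINT; OUR BOOKKEEPING.  **POINTWISE IN THE OUTER LEG, THE Λ-LETTER** (box root; ANY placement `N`, ANY coefficient family `c` — in particular Bałaban's multiplier
response `lamCoeffOf KInv Lc`): `Σ_{α′} dzψb α′ x′·(Σ'_x Σ_α dzψa α x·SΛ κ u x x′ (inl α)(inl α′)) = 0` — each coarse-bond term dies by the four-site lemma. -/
theorem sum_dz_mul_tsum_sum_dz_mul_SLam_hessFFAt_eq_zero (hL : 1 ≤ L) (hr : r ∈ box (d + 1) L)
    (c : Fin (d + 1) → (Fin (d + 1) → ℤ) → Fin (d + 1) → (Fin (d + 1) → ℤ) → ℝ) {ψa ψb : Site (d + 1) → ℝ} (ha hb : Site (d + 1) → ℝ)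
    (hψa : ∀ w, ψa w = ha (blk L w)) (hψb : ∀ w, ψb w = hb (blk L w)) (κ : Fin (d + 1)) (u x' : Site (d + 1)) :
    ∑ α', dz ψb α' x' * ∑' x, ∑ α, dz ψa α x * SLam N c (fun μ y => hessFFAt (toSite r) L μ y) κ u x x' (Sum.inl α) (Sum.inl α') = 0 := by
  refine Finset.sum_eq_zero fun α' _ => ?_
  rw [tsum_dz_mul_SLam_hessFFAt (N := N) hL hr c κ u x' α' ψa, mul_neg, Finset.mul_sum, neg_eq_zero]
  refine Finset.sum_eq_zero fun μ _ => ?_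
  rw [← tsum_mul_left]
  refine (tsum_congr fun y => ?_).trans tsum_zero
  have h := fourSite_mul_dz_mul_linKerAt_eq_zero hL hr ha hb hψa hψb μ y α' x'
  have e : dz ψb α' x' * (c μ y κ u *
        ((ψa x' + ψa (x' + unitVec α') - ψa ((L : ℤ) • y + toSite r) - ψa ((L : ℤ) • y + toSite r + (L : ℤ) • unitVec μ))
          * linKerAt (toSite r) L μ y (α', x') / 2))
      = c μ y κ u * (((ψa x' + ψa (x' + unitVec α') - ψa ((L : ℤ) • y + toSite r) - ψa ((L : ℤ) • y + toSite r + (L : ℤ) • unitVec μ))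
          * (ψb (x' + unitVec α') - ψb x') * linKerAt (toSite r) L μ y (α', x')) / 2) := by
    simp only [AffineAveraging.dz]
    ring
  rw [e, h, zero_div, mul_zero]

/-- NOT IN PRINT; OUR BOOKKEEPING.  **THE Λ-LETTER IS CHARGE-FREE AGAINST `dψa ⊗ dψb` FOR EVERY PAIR OF BLOCK-CONSTANT POTENTIALS, AT EVERY SLOT** (box root; ANY `N`, ANY `c`):
`Σ'_{x′} Σ_{α′} dzψb α′ x′·(Σ'_x Σ_α dzψa α x·SΛ κ u x x′ (inl α)(inl α′)) = 0` — the class-𝒟 twin (and block-label generalisation) of g56 PART 2's exit⊗exit vanishing. -/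
theorem tsum_sum_dz_mul_tsum_sum_dz_mul_SLam_hessFFAt_eq_zero (hL : 1 ≤ L) (hr : r ∈ box (d + 1) L)
    (c : Fin (d + 1) → (Fin (d + 1) → ℤ) → Fin (d + 1) → (Fin (d + 1) → ℤ) → ℝ) {ψa ψb : Site (d + 1) → ℝ} (ha hb : Site (d + 1) → ℝ)
    (hψa : ∀ w, ψa w = ha (blk L w)) (hψb : ∀ w, ψb w = hb (blk L w)) (κ : Fin (d + 1)) (u : Site (d + 1)) :
    ∑' x', ∑ α', dz ψb α' x' * ∑' x, ∑ α, dz ψa α x * SLam N c (fun μ y => hessFFAt (toSite r) L μ y) κ u x x' (Sum.inl α) (Sum.inl α') = 0 := by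
  simp only [sum_dz_mul_tsum_sum_dz_mul_SLam_hessFFAt_eq_zero hL hr c ha hb hψa hψb, tsum_zero]

end BlockConstant

/-! ## §4 The END: the two-leg ff charge of the level-0 step table against `dψa ⊗ dψb` -/

/-- NOT IN PRINT; OUR BOOKKEEPING.  **(I3)_0 — THE TWO-LEG ff CHARGE OF THE LEVEL-0 STEP TABLE AGAINST `dψa ⊗ dψb`, BLOCK-CONSTANT POTENTIALS** (box root `ρ = toSite r`, `Lc ≥ 1`,
`ψa = ha ∘ blk Lc`, `ψb = hb ∘ blk Lc` — ANY `ha hb`; every slot `(κ,u)`):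
`Σ'_z Σ_β dzψb β z·(Σ'_x Σ_α dzψa α x·SrecAt d Lc ρ cE cVH cΛ 0 κ u x z (inl α)(inl β)) = cE·(−¼·(d*d m[ψa,ψb])_κ(u))` — the Wilson letter's share (§1); the Λ-letter contributes
NOTHING (§3) and the border table has no ff block.  A lattice Maxwell image read at the slot, for the whole block class of the tower. -/
theorem tsum_sum_dz_mul_tsum_sum_dz_mul_srecAt_zero {Lc : ℕ} [NeZero Lc] (hLc : 1 ≤ Lc) {r : Fin (d + 1) → ℕ} (hr : r ∈ box (d + 1) Lc) (cE cVH cΛ : ℝ)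
    {ψa ψb : Site (d + 1) → ℝ} (ha hb : Site (d + 1) → ℝ) (hψa : ∀ w, ψa w = ha (blk Lc w)) (hψb : ∀ w, ψb w = hb (blk Lc w))
    (κ : Fin (d + 1)) (u : Site (d + 1)) :
    ∑' z, ∑ β, dz ψb β z * ∑' x, ∑ α, dz ψa α x * SrecAt d Lc (toSite r) cE cVH cΛ 0 κ u x z (Sum.inl α) (Sum.inl β)
      = cE * (-(1 / 4 : ℝ) * curvAdj (curv (fun β z => dz ψb β z * (ψa z + ψa (z + B6BondElimination.unitVec β)))) κ u) := by
  rw [← tsum_sum_dz_mul_tsum_sum_dz_mul_wilsonA ψa ψb κ u, ← tsum_mul_left]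
  refine tsum_congr fun z => ?_
  -- split member `0` into the Wilson letter and the Λ-letter, leg by leg
  have hsplit : ∀ β, ∑' x, ∑ α, dz ψa α x * SrecAt d Lc (toSite r) cE cVH cΛ 0 κ u x z (Sum.inl α) (Sum.inl β)
      = cE * (∑' x, ∑ α, dz ψa α x * wilsonA d κ u x z (Sum.inl α) (Sum.inl β))
        + cΛ * ∑' x, ∑ α, dz ψa α x *
            SLam Lc (lamCoeffOf (KInv (N := Lc) (d := d)) Lc) (fun μ y => hessFFAt (toSite r) Lc μ y) κ u x z (Sum.inl α) (Sum.inl β) := by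
    intro β
    have h1 : Summable fun x => ∑ α, dz ψa α x * wilsonA d κ u x z (Sum.inl α) (Sum.inl β) :=
      summable_sum fun α _ => summable_mul_wilsonA κ u z α β (fun x => dz ψa α x)
    have h2 : Summable fun x => ∑ α, dz ψa α x *
        SLam Lc (lamCoeffOf (KInv (N := Lc) (d := d)) Lc) (fun μ y => hessFFAt (toSite r) Lc μ y) κ u x z (Sum.inl α) (Sum.inl β) :=
      summable_sum fun α _ => summable_mul_SLam_hessFFAt (N := Lc) hLc hr (lamCoeffOf (KInv (N := Lc) (d := d)) Lc) κ u z α β (fun x => dz ψa α x)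
    have e : ∀ x, ∑ α, dz ψa α x * SrecAt d Lc (toSite r) cE cVH cΛ 0 κ u x z (Sum.inl α) (Sum.inl β)
        = cE * (∑ α, dz ψa α x * wilsonA d κ u x z (Sum.inl α) (Sum.inl β))
          + cΛ * ∑ α, dz ψa α x *
              SLam Lc (lamCoeffOf (KInv (N := Lc) (d := d)) Lc) (fun μ y => hessFFAt (toSite r) Lc μ y) κ u x z (Sum.inl α) (Sum.inl β) := by
      intro x
      simp only [srecAt_zero_inl_inl, Finset.mul_sum, ← Finset.sum_add_distrib]
      exact Finset.sum_congr rfl fun α _ => by ring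
    rw [tsum_congr e, Summable.tsum_add (h1.mul_left cE) (h2.mul_left cΛ), tsum_mul_left, tsum_mul_left]
  simp only [hsplit, mul_add, Finset.sum_add_distrib]
  have hΛ := sum_dz_mul_tsum_sum_dz_mul_SLam_hessFFAt_eq_zero (N := Lc) hLc hr (lamCoeffOf (KInv (N := Lc) (d := d)) Lc) ha hb hψa hψb κ u z
  have eΛ : ∑ β, dz ψb β z * (cΛ * ∑' x, ∑ α, dz ψa α x *
        SLam Lc (lamCoeffOf (KInv (N := Lc) (d := d)) Lc) (fun μ y => hessFFAt (toSite r) Lc μ y) κ u x z (Sum.inl α) (Sum.inl β))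
      = cΛ * ∑ β, dz ψb β z * ∑' x, ∑ α, dz ψa α x *
        SLam Lc (lamCoeffOf (KInv (N := Lc) (d := d)) Lc) (fun μ y => hessFFAt (toSite r) Lc μ y) κ u x z (Sum.inl α) (Sum.inl β) := by
    rw [Finset.mul_sum]
    exact Finset.sum_congr rfl fun β _ => by ring
  rw [eΛ, hΛ, mul_zero, add_zero, Finset.mul_sum]
  exact Finset.sum_congr rfl fun β _ => by ring

/-- NOT IN PRINT; OUR BOOKKEEPING.  **THE PURE-S TWIN, EVERY PAIR OF POTENTIALS** (no Λ-letter; the border table `vhSAt` is off the ff block, so only the Wilson letter is read):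
`Σ'_z Σ_β dzφ₂ β z·(Σ'_x Σ_α dzφ₁ α x·SpureRecAt d Lc ρ cE cVH cΛ 0 κ u x z (inl α)(inl β)) = cE·(−¼·(d*d m[φ₁,φ₂])_κ(u))` — for ALL `φ₁ φ₂`, any root offset `ρ`. -/
theorem tsum_sum_dz_mul_tsum_sum_dz_mul_spureRecAt_zero {Lc : ℕ} [NeZero Lc] (ρ : Fin (d + 1) → ℤ) (cE cVH cΛ : ℝ) (φ₁ φ₂ : Site (d + 1) → ℝ)
    (κ : Fin (d + 1)) (u : Site (d + 1)) :
    ∑' z, ∑ β, dz φ₂ β z * ∑' x, ∑ α, dz φ₁ α x * SpureRecAt d Lc ρ cE cVH cΛ 0 κ u x z (Sum.inl α) (Sum.inl β)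
      = cE * (-(1 / 4 : ℝ) * curvAdj (curv (fun β z => dz φ₂ β z * (φ₁ z + φ₁ (z + B6BondElimination.unitVec β)))) κ u) := by
  rw [← tsum_sum_dz_mul_tsum_sum_dz_mul_wilsonA φ₁ φ₂ κ u, ← tsum_mul_left]
  refine tsum_congr fun z => ?_
  rw [Finset.mul_sum]
  refine Finset.sum_congr rfl fun β _ => ?_
  have e : ∀ x, ∑ α, dz φ₁ α x * SpureRecAt d Lc ρ cE cVH cΛ 0 κ u x z (Sum.inl α) (Sum.inl β)
      = cE * ∑ α, dz φ₁ α x * wilsonA d κ u x z (Sum.inl α) (Sum.inl β) := fun x => by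
    rw [Finset.mul_sum]
    exact Finset.sum_congr rfl fun α _ => by rw [spureRecAt_zero_inl_inl]; ring
  rw [tsum_congr e, tsum_mul_left]
  ring

/-- NOT IN PRINT; OUR BOOKKEEPING.  **THE CLASS-𝒟 SINGLE-CHANNEL FORM OF THE END** (box root, `Lc ≥ 1`, channel `(a,b)`, block-constant coordinate potentials `G_i = F_i ∘ (⌊·∕Lc⌋)`,
ANY `F₁ F₂ : ℤ → ℝ`; by `blockPot_forwardDiff` the weights are `𝟙^{exit}_{a}(x)·ΔF₁((blk x)_a)` and `𝟙^{exit}_{b}(z)·ΔF₂((blk z)_b)` — p2's pulled-back weights with `f_i = ΔF_i`):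
`Σ'_z ΔG₂(z_b)·Σ'_x ΔG₁(x_a)·SrecAt d Lc ρ cE cVH cΛ 0 κ u x z (inl a)(inl b) = cE·(−¼·(d*d m)_κ(u))`, `m β z = dz(G₂∘(·)_b) β z·(G₁(z_a) + G₁((z+e_β)_a))`. -/
theorem tsum_blockWt_tsum_blockWt_srecAt_zero {Lc : ℕ} [NeZero Lc] (hLc : 1 ≤ Lc) {r : Fin (d + 1) → ℕ} (hr : r ∈ box (d + 1) Lc) (cE cVH cΛ : ℝ)
    (F₁ F₂ : ℤ → ℝ) (κ : Fin (d + 1)) (u : Site (d + 1)) (a b : Fin (d + 1)) :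
    ∑' z, (F₂ ((z b + 1) / (Lc : ℤ)) - F₂ (z b / (Lc : ℤ))) *
        ∑' x, (F₁ ((x a + 1) / (Lc : ℤ)) - F₁ (x a / (Lc : ℤ))) * SrecAt d Lc (toSite r) cE cVH cΛ 0 κ u x z (Sum.inl a) (Sum.inl b)
      = cE * (-(1 / 4 : ℝ) * curvAdj (curv (fun β z => dz (fun w : Fin (d + 1) → ℤ => F₂ (w b / (Lc : ℤ))) β z
          * (F₁ (z a / (Lc : ℤ)) + F₁ ((z + B6BondElimination.unitVec β) a / (Lc : ℤ))))) κ u) := by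
  have h := tsum_sum_dz_mul_tsum_sum_dz_mul_srecAt_zero hLc hr cE cVH cΛ (ψa := fun w : Site (d + 1) => F₁ (w a / (Lc : ℤ)))
    (ψb := fun w : Site (d + 1) => F₂ (w b / (Lc : ℤ))) (fun y => F₁ (y a)) (fun y => F₂ (y b)) (fun w => rfl) (fun w => rfl) κ u
  have e1 : ∀ (x : Site (d + 1)) (T : Fin (d + 1) → ℝ), ∑ α, dz (fun w : Site (d + 1) => F₁ (w a / (Lc : ℤ))) α x * T α
      = (F₁ ((x a + 1) / (Lc : ℤ)) - F₁ (x a / (Lc : ℤ))) * T a := fun x T =>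
    sum_dz_coordPot_mul (fun t => F₁ (t / (Lc : ℤ))) a x T
  have e2 : ∀ (z : Site (d + 1)) (T : Fin (d + 1) → ℝ), ∑ β, dz (fun w : Site (d + 1) => F₂ (w b / (Lc : ℤ))) β z * T β
      = (F₂ ((z b + 1) / (Lc : ℤ)) - F₂ (z b / (Lc : ℤ))) * T b := fun z T =>
    sum_dz_coordPot_mul (fun t => F₂ (t / (Lc : ℤ))) b z T
  simp only [e1, e2] at h
  exact h

/-- NOT IN PRINT; OUR BOOKKEEPING.  **SAME DIRECTION: THE CLASS-𝒟 CHARGE OF MEMBER `0` VANISHES AT EVERY SLOT** (`a = b`, ANY `F₁ F₂`). -/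
theorem tsum_blockWt_tsum_blockWt_srecAt_zero_same {Lc : ℕ} [NeZero Lc] (hLc : 1 ≤ Lc) {r : Fin (d + 1) → ℕ} (hr : r ∈ box (d + 1) Lc) (cE cVH cΛ : ℝ)
    (F₁ F₂ : ℤ → ℝ) (κ : Fin (d + 1)) (u : Site (d + 1)) (a : Fin (d + 1)) :
    ∑' z, (F₂ ((z a + 1) / (Lc : ℤ)) - F₂ (z a / (Lc : ℤ))) *
        ∑' x, (F₁ ((x a + 1) / (Lc : ℤ)) - F₁ (x a / (Lc : ℤ))) * SrecAt d Lc (toSite r) cE cVH cΛ 0 κ u x z (Sum.inl a) (Sum.inl a) = 0 := by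
  rw [tsum_blockWt_tsum_blockWt_srecAt_zero hLc hr cE cVH cΛ F₁ F₂ κ u a a,
    curvAdj_curv_pairForm_coord_same (fun t => F₁ (t / (Lc : ℤ))) (fun t => F₂ (t / (Lc : ℤ))) a κ u, mul_zero, mul_zero]

/-! ## §5 The pair (product) form on `Site × Site` — road-P2's currency (`ChargeTowerStep` ∕ `ChargeTowerClimb` read `Σ'_{(x,z)} g₁(x)·g₂(z)·S κ u x z a b`) -/

/-- [folklore] A bi-localised kernel entry against two BOUNDED leg weights is summable on `Site × Site` (leaf-06's `summable_prod_of_biLoc` with the weights' sup as a factor). -/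
theorem summable_prod_wt_mul_of_biLoc {K : MKer (d + 1) (Fib d)} {p q : Site (d + 1)} {C δ : ℝ} (hK : BiLoc K p q C δ) (hδ : 0 < δ)
    {g₁ g₂ : Site (d + 1) → ℝ} {B₁ B₂ : ℝ} (hg₁ : ∀ x, |g₁ x| ≤ B₁) (hg₂ : ∀ z, |g₂ z| ≤ B₂) (a b : Fib d) :
    Summable fun xz : Site (d + 1) × Site (d + 1) => g₁ xz.1 * g₂ xz.2 * K xz.1 xz.2 a b := by
  have hC : 0 ≤ C := hK.nonneg a
  have hB₁ : 0 ≤ B₁ := (abs_nonneg _).trans (hg₁ p)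
  have hB₂ : 0 ≤ B₂ := (abs_nonneg _).trans (hg₂ q)
  have h1 : Summable fun x : Site (d + 1) => Real.exp (-δ * l1 (x - p)) := summable_exp_shift' hδ p
  have h2 : Summable fun z : Site (d + 1) => Real.exp (-δ * l1 (z - q)) := summable_exp_shift' hδ q
  have hprod : Summable fun xz : Site (d + 1) × Site (d + 1) =>
      (B₁ * B₂ * C) * (Real.exp (-δ * l1 (xz.1 - p)) * Real.exp (-δ * l1 (xz.2 - q))) :=
    (h1.mul_of_nonneg h2 (fun _ => (Real.exp_pos _).le) (fun _ => (Real.exp_pos _).le)).mul_left _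
  refine Summable.of_norm_bounded hprod (fun xz => ?_)
  rw [Real.norm_eq_abs, abs_mul, abs_mul]
  have hk := hK xz.1 xz.2 a b
  rw [mul_add, Real.exp_add] at hk
  calc |g₁ xz.1| * |g₂ xz.2| * |K xz.1 xz.2 a b|
      ≤ B₁ * B₂ * (C * (Real.exp (-δ * l1 (xz.1 - p)) * Real.exp (-δ * l1 (xz.2 - q)))) :=
        mul_le_mul (mul_le_mul (hg₁ _) (hg₂ _) (abs_nonneg _) hB₁) hk (abs_nonneg _) (mul_nonneg hB₁ hB₂)
    _ = (B₁ * B₂ * C) * (Real.exp (-δ * l1 (xz.1 - p)) * Real.exp (-δ * l1 (xz.2 - q))) := by ring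

/-- NOT IN PRINT; OUR BOOKKEEPING.  **(I3)_0 IN ROAD-P2's PAIR CURRENCY** (box root, `Lc ≥ 1`, channel `(a,b)`; block-constant coordinate potentials `G_i = F_i∘(⌊·∕Lc⌋)` with BOUNDED
coarse differences `|ΔF_i| ≤ D_i` — p2's bounded `f_i = ΔF_i`):
`Σ'_{(x,z)} ΔG₁(x_a)·ΔG₂(z_b)·SrecAt d Lc ρ cE cVH cΛ 0 κ u x z (inl a)(inl b) = cE·(−¼·(d*d m)_κ(u))` as a `HasSum` on `Site × Site` (summability from leaf-10∕an2's
`locStencil_SrecAt`; the pair sum is the iterated one of §4 by Fubini). -/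
theorem hasSum_prod_blockWt_srecAt_zero {Lc : ℕ} [NeZero Lc] (hLc : 1 ≤ Lc) {r : Fin (d + 1) → ℕ} (hr : r ∈ box (d + 1) Lc) (cE cVH cΛ : ℝ)
    (F₁ F₂ : ℤ → ℝ) {D₁ D₂ : ℝ} (hF₁ : ∀ t, |F₁ (t + 1) - F₁ t| ≤ D₁) (hF₂ : ∀ t, |F₂ (t + 1) - F₂ t| ≤ D₂)
    (κ : Fin (d + 1)) (u : Site (d + 1)) (a b : Fin (d + 1)) :
    HasSum (fun xz : Site (d + 1) × Site (d + 1) =>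
        (F₁ ((xz.1 a + 1) / (Lc : ℤ)) - F₁ (xz.1 a / (Lc : ℤ))) * (F₂ ((xz.2 b + 1) / (Lc : ℤ)) - F₂ (xz.2 b / (Lc : ℤ)))
          * SrecAt d Lc (toSite r) cE cVH cΛ 0 κ u xz.1 xz.2 (Sum.inl a) (Sum.inl b))
      (cE * (-(1 / 4 : ℝ) * curvAdj (curv (fun β z => dz (fun w : Fin (d + 1) → ℤ => F₂ (w b / (Lc : ℤ))) β z
          * (F₁ (z a / (Lc : ℤ)) + F₁ ((z + B6BondElimination.unitVec β) a / (Lc : ℤ))))) κ u)) := by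
  obtain ⟨Cs, δ, hδ, hS⟩ := locStencil_SrecAt (d := d) (Lc := Lc) hLc hr cE cVH cΛ 0
  have hD₁ : 0 ≤ D₁ := (abs_nonneg _).trans (hF₁ 0)
  have hD₂ : 0 ≤ D₂ := (abs_nonneg _).trans (hF₂ 0)
  have hw₁ : ∀ x : Site (d + 1), |F₁ ((x a + 1) / (Lc : ℤ)) - F₁ (x a / (Lc : ℤ))| ≤ D₁ := fun x => by
    rw [int_ediv_add_one hLc]
    split_ifs
    · exact hF₁ _
    · rw [add_zero, sub_self, abs_zero]; exact hD₁
  have hw₂ : ∀ z : Site (d + 1), |F₂ ((z b + 1) / (Lc : ℤ)) - F₂ (z b / (Lc : ℤ))| ≤ D₂ := fun z => by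
    rw [int_ediv_add_one hLc]
    split_ifs
    · exact hF₂ _
    · rw [add_zero, sub_self, abs_zero]; exact hD₂
  have hsum := summable_prod_wt_mul_of_biLoc (hS κ u) hδ hw₁ hw₂ (Sum.inl a) (Sum.inl b)
  rw [← tsum_blockWt_tsum_blockWt_srecAt_zero hLc hr cE cVH cΛ F₁ F₂ κ u a b]
  have e := tsum_prod_eq_tsum_tsum_swap (F := fun x z => (F₁ ((x a + 1) / (Lc : ℤ)) - F₁ (x a / (Lc : ℤ)))
    * (F₂ ((z b + 1) / (Lc : ℤ)) - F₂ (z b / (Lc : ℤ))) * SrecAt d Lc (toSite r) cE cVH cΛ 0 κ u x z (Sum.inl a) (Sum.inl b)) hsum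
  have e2 : ∀ z : Site (d + 1), ∑' x, (F₁ ((x a + 1) / (Lc : ℤ)) - F₁ (x a / (Lc : ℤ))) * (F₂ ((z b + 1) / (Lc : ℤ)) - F₂ (z b / (Lc : ℤ)))
        * SrecAt d Lc (toSite r) cE cVH cΛ 0 κ u x z (Sum.inl a) (Sum.inl b)
      = (F₂ ((z b + 1) / (Lc : ℤ)) - F₂ (z b / (Lc : ℤ))) * ∑' x, (F₁ ((x a + 1) / (Lc : ℤ)) - F₁ (x a / (Lc : ℤ)))
        * SrecAt d Lc (toSite r) cE cVH cΛ 0 κ u x z (Sum.inl a) (Sum.inl b) := fun z => by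
    rw [← tsum_mul_left]
    exact tsum_congr fun x => by ring
  simp only [e2] at e
  rw [← e]
  exact hsum.hasSum

/-- NOT IN PRINT; OUR BOOKKEEPING.  **THE PURE-S TWIN IN PAIR CURRENCY, EVERY PAIR OF SINGLE-COORDINATE POTENTIALS WITH BOUNDED DIFFERENCES** (box root; no Λ-letter, so no
block-constancy needed — plain, exit, slab, entry, weighted classes alike):
`Σ'_{(x,z)} ΔG₁(x_a)·ΔG₂(z_b)·SpureRecAt d Lc ρ cE cVH cΛ 0 κ u x z (inl a)(inl b) = cE·(−¼·(d*d m)_κ(u))`. -/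
theorem hasSum_prod_coordWt_spureRecAt_zero {Lc : ℕ} [NeZero Lc] (hLc : 1 ≤ Lc) {r : Fin (d + 1) → ℕ} (hr : r ∈ box (d + 1) Lc) (cE cVH cΛ : ℝ)
    (G₁ G₂ : ℤ → ℝ) {D₁ D₂ : ℝ} (hG₁ : ∀ t, |G₁ (t + 1) - G₁ t| ≤ D₁) (hG₂ : ∀ t, |G₂ (t + 1) - G₂ t| ≤ D₂)
    (κ : Fin (d + 1)) (u : Site (d + 1)) (a b : Fin (d + 1)) :
    HasSum (fun xz : Site (d + 1) × Site (d + 1) =>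
        (G₁ (xz.1 a + 1) - G₁ (xz.1 a)) * (G₂ (xz.2 b + 1) - G₂ (xz.2 b)) * SpureRecAt d Lc (toSite r) cE cVH cΛ 0 κ u xz.1 xz.2 (Sum.inl a) (Sum.inl b))
      (cE * (-(1 / 4 : ℝ) * curvAdj (curv (fun β z => dz (fun w : Fin (d + 1) → ℤ => G₂ (w b)) β z
          * (G₁ (z a) + G₁ ((z + B6BondElimination.unitVec β) a)))) κ u)) := by
  obtain ⟨Cs, δ, hδ, hS⟩ := locStencil_SpureRecAt (d := d) (Lc := Lc) hLc hr cE cVH cΛ 0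
  have hsum := summable_prod_wt_mul_of_biLoc (hS κ u) hδ (fun x : Site (d + 1) => hG₁ (x a)) (fun z : Site (d + 1) => hG₂ (z b)) (Sum.inl a) (Sum.inl b)
  have hval : ∑' z, (G₂ (z b + 1) - G₂ (z b)) * ∑' x, (G₁ (x a + 1) - G₁ (x a)) * SpureRecAt d Lc (toSite r) cE cVH cΛ 0 κ u x z (Sum.inl a) (Sum.inl b)
      = cE * (-(1 / 4 : ℝ) * curvAdj (curv (fun β z => dz (fun w : Fin (d + 1) → ℤ => G₂ (w b)) β z
          * (G₁ (z a) + G₁ ((z + B6BondElimination.unitVec β) a)))) κ u) := by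
    rw [← tsum_coordWt_tsum_coordWt_wilsonA G₁ G₂ κ u a b, ← tsum_mul_left]
    refine tsum_congr fun z => ?_
    have e : ∀ x, (G₁ (x a + 1) - G₁ (x a)) * SpureRecAt d Lc (toSite r) cE cVH cΛ 0 κ u x z (Sum.inl a) (Sum.inl b)
        = cE * ((G₁ (x a + 1) - G₁ (x a)) * wilsonA d κ u x z (Sum.inl a) (Sum.inl b)) := fun x => by
      rw [spureRecAt_zero_inl_inl]; ring
    rw [tsum_congr e, tsum_mul_left]
    ring
  rw [← hval]
  have e := tsum_prod_eq_tsum_tsum_swap (F := fun x z => (G₁ (x a + 1) - G₁ (x a)) * (G₂ (z b + 1) - G₂ (z b))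
    * SpureRecAt d Lc (toSite r) cE cVH cΛ 0 κ u x z (Sum.inl a) (Sum.inl b)) hsum
  have e2 : ∀ z : Site (d + 1), ∑' x, (G₁ (x a + 1) - G₁ (x a)) * (G₂ (z b + 1) - G₂ (z b)) * SpureRecAt d Lc (toSite r) cE cVH cΛ 0 κ u x z (Sum.inl a) (Sum.inl b)
      = (G₂ (z b + 1) - G₂ (z b)) * ∑' x, (G₁ (x a + 1) - G₁ (x a)) * SpureRecAt d Lc (toSite r) cE cVH cΛ 0 κ u x z (Sum.inl a) (Sum.inl b) := fun z => by
    rw [← tsum_mul_left]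
    exact tsum_congr fun x => by ring
  simp only [e2] at e
  rw [← e]
  exact hsum.hasSum

/-- [folklore] PART A's `blockPot_forwardDiff` read with a primitive: if `ΔF = f` then `F((t+1)∕L) − F(t∕L) = 𝟙[t % L = L−1]·f(⌊t∕L⌋)` — road-P2's spelling of the class-𝒟 weight
(`ChargeTowerStep` ∕ `ChargeTowerClimb`: `if y_α % Lc = Lc − 1 then f (blk Lc y α) else 0`, `blk Lc y α = y_α ∕ Lc` by `rfl`). -/
theorem blockPot_forwardDiff_eq_exitWt {L : ℕ} (hL : 1 ≤ L) {F f : ℤ → ℝ} (hF : ∀ t, F (t + 1) - F t = f t) (t : ℤ) :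
    F ((t + 1) / (L : ℤ)) - F (t / (L : ℤ)) = if t % (L : ℤ) = (L : ℤ) - 1 then f (t / (L : ℤ)) else 0 := by
  rw [blockPot_forwardDiff hL, hF]
  split_ifs
  · rw [one_mul]
  · rw [zero_mul]

/-- NOT IN PRINT; OUR BOOKKEEPING.  **(I3)_0 IN ROAD-P2's LITERAL CURRENCY** (box root, `Lc ≥ 1`, channel `(a,b)`; BOUNDED coarse weights `f₁ f₂ : ℤ → ℝ` and ANY primitives `F_i`
with `ΔF_i = f_i` — PART A's `exists_forwardDiff_eq` supplies one): with p2's exit-supported block-constant weights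
`g₁(x) = 𝟙[x_a % Lc = Lc−1]·f₁((blk Lc x)_a)`, `g₂(z) = 𝟙[z_b % Lc = Lc−1]·f₂((blk Lc z)_b)`,
`HasSum ((x,z) ↦ g₁(x)·g₂(z)·SrecAt d Lc ρ cE cVH cΛ 0 κ u x z (inl a)(inl b)) (cE·(−¼·(d*d m[F₁∘⌊·_a∕Lc⌋, F₂∘⌊·_b∕Lc⌋])_κ(u)))` — the hypothesis `hC` of p2's
`ChargeTowerClimb.hasSum_prod_coordWeighted_SpureRecAt_of_exact_add_const` one level down, with the level-0 Maxwell operator in place of `Δ_{j+1}` and constant `c = 0`. -/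
theorem hasSum_prod_exitWt_srecAt_zero {Lc : ℕ} [NeZero Lc] (hLc : 1 ≤ Lc) {r : Fin (d + 1) → ℕ} (hr : r ∈ box (d + 1) Lc) (cE cVH cΛ : ℝ)
    {F₁ F₂ f₁ f₂ : ℤ → ℝ} (hF₁ : ∀ t, F₁ (t + 1) - F₁ t = f₁ t) (hF₂ : ∀ t, F₂ (t + 1) - F₂ t = f₂ t) {B₁ B₂ : ℝ} (hf₁ : ∀ s, |f₁ s| ≤ B₁) (hf₂ : ∀ s, |f₂ s| ≤ B₂)
    (κ : Fin (d + 1)) (u : Site (d + 1)) (a b : Fin (d + 1)) :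
    HasSum (fun xz : Site (d + 1) × Site (d + 1) =>
        (if xz.1 a % (Lc : ℤ) = (Lc : ℤ) - 1 then f₁ (blk Lc xz.1 a) else 0) * (if xz.2 b % (Lc : ℤ) = (Lc : ℤ) - 1 then f₂ (blk Lc xz.2 b) else 0)
          * SrecAt d Lc (toSite r) cE cVH cΛ 0 κ u xz.1 xz.2 (Sum.inl a) (Sum.inl b))
      (cE * (-(1 / 4 : ℝ) * curvAdj (curv (fun β z => dz (fun w : Fin (d + 1) → ℤ => F₂ (w b / (Lc : ℤ))) β z
          * (F₁ (z a / (Lc : ℤ)) + F₁ ((z + B6BondElimination.unitVec β) a / (Lc : ℤ))))) κ u)) := by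
  have hD₁ : ∀ t, |F₁ (t + 1) - F₁ t| ≤ B₁ := fun t => by rw [hF₁]; exact hf₁ t
  have hD₂ : ∀ t, |F₂ (t + 1) - F₂ t| ≤ B₂ := fun t => by rw [hF₂]; exact hf₂ t
  refine (hasSum_prod_blockWt_srecAt_zero hLc hr cE cVH cΛ F₁ F₂ hD₁ hD₂ κ u a b).congr_fun fun xz => ?_
  show _ = _
  rw [blockPot_forwardDiff_eq_exitWt hLc hF₁, blockPot_forwardDiff_eq_exitWt hLc hF₂]
  rfl

/-- [folklore] `d*d` commutes with a constant factor: `d*d(a•m) = a•d*d m` (pointwise). -/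
theorem curvAdj_curv_const_mul (c : ℝ) (m : Form1 (d + 1) ℝ) (κ : Fin (d + 1)) (u : Site (d + 1)) :
    curvAdj (curv (fun β z => c * m β z)) κ u = c * curvAdj (curv m) κ u := by
  simp only [AffineAveraging.curvAdj, AffineAveraging.curv, Finset.mul_sum, mul_add, mul_sub]

/-- NOT IN PRINT; OUR BOOKKEEPING.  **(I3)_0 AS ROAD-P2's HYPOTHESIS `hC` AT LEVEL 0, CONSTANT FOLDED** (p2 g41 INTENT 5 `ChargeTowerClimbZero` §4: «IF the charge function of the FULL level-0
member against `𝟙^{exit}_α·f₁∘blk ⊗ 𝟙^{exit}_β·f₂∘blk` is `(d*d m) + c` THEN …» — here with `m := (−cE∕4)•m[F₁∘⌊·_a∕Lc⌋, F₂∘⌊·_b∕Lc⌋]` and `c = 0`; bounded `f_i`, ANY primitives `F_i`):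
`Σ'_{(x,z)} (𝟙[x_a % Lc = Lc−1]·f₁(blk Lc x a))·(𝟙[z_b % Lc = Lc−1]·f₂(blk Lc z b))·SrecAt d Lc ρ cE cVH cΛ 0 κ u x z (inl a)(inl b) = (d*d ((−cE∕4)•m))_κ(u)`. -/
theorem tsum_prod_exitWt_srecAt_zero {Lc : ℕ} [NeZero Lc] (hLc : 1 ≤ Lc) {r : Fin (d + 1) → ℕ} (hr : r ∈ box (d + 1) Lc) (cE cVH cΛ : ℝ)
    {F₁ F₂ f₁ f₂ : ℤ → ℝ} (hF₁ : ∀ t, F₁ (t + 1) - F₁ t = f₁ t) (hF₂ : ∀ t, F₂ (t + 1) - F₂ t = f₂ t) {B₁ B₂ : ℝ} (hf₁ : ∀ s, |f₁ s| ≤ B₁) (hf₂ : ∀ s, |f₂ s| ≤ B₂)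
    (κ : Fin (d + 1)) (u : Site (d + 1)) (a b : Fin (d + 1)) :
    ∑' xz : Site (d + 1) × Site (d + 1),
        (if xz.1 a % (Lc : ℤ) = (Lc : ℤ) - 1 then f₁ (blk Lc xz.1 a) else 0) * (if xz.2 b % (Lc : ℤ) = (Lc : ℤ) - 1 then f₂ (blk Lc xz.2 b) else 0)
          * SrecAt d Lc (toSite r) cE cVH cΛ 0 κ u xz.1 xz.2 (Sum.inl a) (Sum.inl b)
      = curvAdj (curv (fun β z => (-(cE / 4)) * (dz (fun w : Fin (d + 1) → ℤ => F₂ (w b / (Lc : ℤ))) β z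
          * (F₁ (z a / (Lc : ℤ)) + F₁ ((z + B6BondElimination.unitVec β) a / (Lc : ℤ)))))) κ u := by
  rw [(hasSum_prod_exitWt_srecAt_zero hLc hr cE cVH cΛ hF₁ hF₂ hf₁ hf₂ κ u a b).tsum_eq, curvAdj_curv_const_mul]
  ring

end Summit.QuantumFields.BalabanUV.Beta.GAN24.SrecChargeBlockPotentials

end
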